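import Mathlib
import HarnessLib
import Summits.Ventures.LatticeQCDFlow.Exactness.NCMCGeneralSpaceKernel

/-!
# The NCMC lane's iteration kernel, set-wise: lower bounds through the level samplers, and where Crooks' identity forces records to start and end

HONEST FRAMING: exact (Metropolis-corrected) sampling algorithms for lattice gauge theory;
figures of merit are autocorrelation/cost numbers at stated couplings and volumes; no
continuum-physics claim.

Venture `LatticeQCDFlow` (cell pub-lqcd), topic `Exactness`; FANOUT row 13 (`eng-snf`, GEN-17).
NEW WORK of the cell (elementary measure theory), not a published result; no definition is
introduced; nothing is cited as a fact.  Groundwork for `NCMCGeneralSpaceOccupancyChainErgodic.lean`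
(the ergodicity certificate of `latflow-snf`'s `run_ncmc_chain`), in the setting of
`NCMCGeneralSpace.lean` / `NCMCGeneralSpaceKernel.lean`: a Crooks pair `(κF, κR, s, e, W)` between
level weights `ν₀`, `ν₁`, the accepted flows `fwdFlow` / `revFlow`, the switch kernel
`switchKernel κF κR c W s e` and the level kernel `levelKernel T₀ T₁` on `Bool × Ω`.

## Content

* §1 `isMarkovKernel_levelKernel`; `levelKernel_prior_eq` / `levelKernel_target_eq`;
  `iteration_apply_prior` / `iteration_apply_target` — one iteration
  `switchKernel ∘ₖ levelKernel T₀ T₁` from `(prior, x)` is `∫ switchKernel((prior, x'), ·) dT₀(x, x')`;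
  **`lintegral_fwdFlow_le_iteration`** / **`lintegral_revFlow_le_iteration`** — if `m₀ ≤ T₀(x, ·)`,
  one iteration from `(prior, x)` charges `S` with at least `∫ F_c(x', S_target) dm₀(x')`
  (symmetrically from the target level with `m₁`, `R_c`).
* §2 `fwdFlow_add_compl` / `revFlow_add_compl` (additivity in the set); **`fwdFlow_univ_ne_zero`** /
  **`revFlow_univ_ne_zero`** — the acceptance masses `∫ min(1, e^{∓(W−c)}) dκ` are NEVER zero
  (pointwise positive acceptance, probability record laws); `measure_eq_zero_of_lintegral_fwdFlow_univ`
  / `…revFlow…`; `fwdFlow_le_kernel` / `revFlow_le_kernel` (`F_c(x, A) ≤ κF(x, e⁻¹A)`);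
  **`absolutelyContinuous_of_le_invariant`** — a measure below every row of a `ν`-invariant kernel
  is `≪ ν`.
* §3 (Crooks pairs) `kernel_end_preimage` / `kernel_start_preimage` (`κR(y, e⁻¹A) = 1_A(y)`,
  `κF(x, s⁻¹A) = 1_A(x)`); **`ae_kernel_end_null`** — `ν₁(A) = 0 ⇒ κF(x, e⁻¹A) = 0` for `ν₀`-a.e. `x`:
  FORWARD RECORDS END `ν₁`-ALMOST SURELY WHERE THEY SHOULD (Crooks' identity with `e^{−W} > 0`);
  **`ae_kernel_start_null`** — `ν₀(A) = 0 ⇒ κR(y, s⁻¹A) = 0` for `ν₁`-a.e. `y`;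
  `ae_fwdFlow_eq_univ` / `ae_revFlow_eq_univ` — the flow versions.

Nothing is claimed beyond these identities and inequalities.
-/

namespace Summit.Ventures.LatticeQCDFlow.Exactness.GeneralNCMC

open MeasureTheory ProbabilityTheory Set Filter
open scoped ENNReal

variable {Ω E : Type*} [MeasurableSpace Ω] [MeasurableSpace E]

/-! ## §1 One iteration of the engine, set-wise, and its lower bounds -/

section Step

variable {κF κR : Kernel Ω E} [IsMarkovKernel κF] [IsMarkovKernel κR] {c : ℝ} {W : E → ℝ}
  {s e : E → Ω} (T₀ T₁ : Kernel Ω Ω)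

/-- Level-wise relaxation by Markov kernels is a Markov kernel. -/
theorem isMarkovKernel_levelKernel [IsMarkovKernel T₀] [IsMarkovKernel T₁] :
    IsMarkovKernel (levelKernel T₀ T₁) := by
  haveI := Kernel.IsMarkovKernel.map T₁
    (show Measurable (Prod.mk true : Ω → Bool × Ω) from measurable_prodMk_left)
  haveI := Kernel.IsMarkovKernel.map T₀
    (show Measurable (Prod.mk false : Ω → Bool × Ω) from measurable_prodMk_left)
  unfold levelKernel
  infer_instance

/-- From a prior state the level kernel is `T₀` tagged with the prior level. -/
theorem levelKernel_prior_eq (x : Ω) :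
    levelKernel T₀ T₁ (false, x) = (T₀ x).map (Prod.mk false) := by
  have hnot : (false, x) ∉ targetLevel Ω := by simp
  rw [levelKernel, Kernel.piecewise_apply, if_neg hnot, Kernel.prodMkLeft_apply,
    Kernel.map_apply _ measurable_prodMk_left]

/-- From a target state the level kernel is `T₁` tagged with the target level. -/
theorem levelKernel_target_eq (y : Ω) :
    levelKernel T₀ T₁ (true, y) = (T₁ y).map (Prod.mk true) := by
  have hmem : (true, y) ∈ targetLevel Ω := by simp
  rw [levelKernel, Kernel.piecewise_apply, if_pos hmem, Kernel.prodMkLeft_apply,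
    Kernel.map_apply _ measurable_prodMk_left]

/-- One iteration from a prior state: relax with `T₀`, then switch. -/
theorem iteration_apply_prior (x : Ω) {S : Set (Bool × Ω)} (hS : MeasurableSet S) :
    (switchKernel κF κR c W s e ∘ₖ levelKernel T₀ T₁) (false, x) S =
      ∫⁻ x', switchKernel κF κR c W s e (false, x') S ∂(T₀ x) := by
  rw [Kernel.comp_apply' _ _ _ hS, levelKernel_prior_eq,
    lintegral_map (Kernel.measurable_coe _ hS) measurable_prodMk_left]

/-- One iteration from a target state: relax with `T₁`, then switch. -/
theorem iteration_apply_target (y : Ω) {S : Set (Bool × Ω)} (hS : MeasurableSet S) :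
    (switchKernel κF κR c W s e ∘ₖ levelKernel T₀ T₁) (true, y) S =
      ∫⁻ y', switchKernel κF κR c W s e (true, y') S ∂(T₁ y) := by
  rw [Kernel.comp_apply' _ _ _ hS, levelKernel_target_eq,
    lintegral_map (Kernel.measurable_coe _ hS) measurable_prodMk_left]

/-- **Lower bound from a prior state**: if `m₀ ≤ T₀(x, ·)`, one iteration charges `S` with at least
the `m₀`-averaged accepted forward flow into the target part of `S`. -/
theorem lintegral_fwdFlow_le_iteration (hW : Measurable W) (he : Measurable e) {m₀ : Measure Ω}
    {x : Ω} (hmin : m₀ ≤ T₀ x) {S : Set (Bool × Ω)} (hS : MeasurableSet S) :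
    ∫⁻ x', fwdFlow κF c W e x' (Prod.mk true ⁻¹' S) ∂m₀ ≤
      (switchKernel κF κR c W s e ∘ₖ levelKernel T₀ T₁) (false, x) S := by
  rw [iteration_apply_prior T₀ T₁ x hS]
  calc ∫⁻ x', fwdFlow κF c W e x' (Prod.mk true ⁻¹' S) ∂m₀
      ≤ ∫⁻ x', fwdFlow κF c W e x' (Prod.mk true ⁻¹' S) ∂(T₀ x) := lintegral_mono' hmin le_rfl
    _ ≤ ∫⁻ x', switchKernel κF κR c W s e (false, x') S ∂(T₀ x) :=
        lintegral_mono fun x' => by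
          rw [switchKernel_apply_prior hW he x' hS]
          exact le_self_add

/-- **Lower bound from a target state**: if `m₁ ≤ T₁(y, ·)`, one iteration charges `S` with at least
the `m₁`-averaged accepted reverse flow into the prior part of `S`. -/
theorem lintegral_revFlow_le_iteration (hW : Measurable W) (hs : Measurable s) {m₁ : Measure Ω}
    {y : Ω} (hmin : m₁ ≤ T₁ y) {S : Set (Bool × Ω)} (hS : MeasurableSet S) :
    ∫⁻ y', revFlow κR c W s y' (Prod.mk false ⁻¹' S) ∂m₁ ≤
      (switchKernel κF κR c W s e ∘ₖ levelKernel T₀ T₁) (true, y) S := by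
  rw [iteration_apply_target T₀ T₁ y hS]
  calc ∫⁻ y', revFlow κR c W s y' (Prod.mk false ⁻¹' S) ∂m₁
      ≤ ∫⁻ y', revFlow κR c W s y' (Prod.mk false ⁻¹' S) ∂(T₁ y) := lintegral_mono' hmin le_rfl
    _ ≤ ∫⁻ y', switchKernel κF κR c W s e (true, y') S ∂(T₁ y) :=
        lintegral_mono fun y' => by
          rw [switchKernel_apply_target hW hs y' hS]
          exact le_self_add

end Step

/-! ## §2 The accepted flows: additivity, positivity, domination by the record kernel -/

section Flows

variable (κF κR : Kernel Ω E) (c : ℝ) {W : E → ℝ} {s e : E → Ω}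

/-- The accepted forward flow is additive over a set and its complement. -/
theorem fwdFlow_add_compl (hW : Measurable W) (he : Measurable e) (x : Ω) {A : Set Ω}
    (hA : MeasurableSet A) :
    fwdFlow κF c W e x A + fwdFlow κF c W e x Aᶜ = fwdFlow κF c W e x univ := by
  unfold fwdFlow
  have hm : Measurable fun ε => accF c W ε * A.indicator 1 (e ε) :=
    (measurable_accF c hW).mul ((measurable_one.indicator hA).comp he)
  rw [← lintegral_add_left hm]
  refine lintegral_congr fun ε => ?_
  rw [← mul_add, indicator_univ, Pi.one_apply]
  by_cases hε : e ε ∈ A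
  · rw [indicator_of_mem hε, indicator_of_notMem (Set.notMem_compl_iff.2 hε), Pi.one_apply,
      add_zero]
  · rw [indicator_of_notMem hε, indicator_of_mem (Set.mem_compl hε), Pi.one_apply, zero_add]

/-- The accepted reverse flow is additive over a set and its complement. -/
theorem revFlow_add_compl (hW : Measurable W) (hs : Measurable s) (y : Ω) {A : Set Ω}
    (hA : MeasurableSet A) :
    revFlow κR c W s y A + revFlow κR c W s y Aᶜ = revFlow κR c W s y univ := by
  unfold revFlow
  have hm : Measurable fun ε => accR c W ε * A.indicator 1 (s ε) :=
    (measurable_accR c hW).mul ((measurable_one.indicator hA).comp hs)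
  rw [← lintegral_add_left hm]
  refine lintegral_congr fun ε => ?_
  rw [← mul_add, indicator_univ, Pi.one_apply]
  by_cases hε : s ε ∈ A
  · rw [indicator_of_mem hε, indicator_of_notMem (Set.notMem_compl_iff.2 hε), Pi.one_apply,
      add_zero]
  · rw [indicator_of_notMem hε, indicator_of_mem (Set.mem_compl hε), Pi.one_apply, zero_add]

/-- **The forward acceptance mass is never zero**: `min(1, e^{−(W−c)}) > 0` pointwise and `κF x` is a
probability law. -/
theorem fwdFlow_univ_ne_zero [IsMarkovKernel κF] (hW : Measurable W) (x : Ω) :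
    fwdFlow κF c W e x univ ≠ 0 := by
  intro h0
  rw [fwdFlow_univ, lintegral_eq_zero_iff (measurable_accF c hW)] at h0
  have hfalse : ∀ᵐ ε ∂(κF x), False := h0.mono fun ε hε =>
    (ENNReal.ofReal_pos.2 (lt_min one_pos (Real.exp_pos _))).ne' hε
  rw [eventually_false_iff_eq_bot, ae_eq_bot] at hfalse
  exact IsProbabilityMeasure.ne_zero (κF x) hfalse

/-- **The reverse acceptance mass is never zero.** -/
theorem revFlow_univ_ne_zero [IsMarkovKernel κR] (hW : Measurable W) (y : Ω) :
    revFlow κR c W s y univ ≠ 0 := by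
  intro h0
  rw [revFlow_univ, lintegral_eq_zero_iff (measurable_accR c hW)] at h0
  have hfalse : ∀ᵐ ε ∂(κR y), False := h0.mono fun ε hε =>
    (ENNReal.ofReal_pos.2 (lt_min one_pos (Real.exp_pos _))).ne' hε
  rw [eventually_false_iff_eq_bot, ae_eq_bot] at hfalse
  exact IsProbabilityMeasure.ne_zero (κR y) hfalse

/-- A measure under which the forward acceptance mass integrates to zero is the zero measure. -/
theorem measure_eq_zero_of_lintegral_fwdFlow_univ [IsMarkovKernel κF] (hW : Measurable W)
    (he : Measurable e) {m : Measure Ω} (hm : ∫⁻ x, fwdFlow κF c W e x univ ∂m = 0) : m = 0 := by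
  rw [lintegral_eq_zero_iff (measurable_fwdFlow κF c hW he MeasurableSet.univ)] at hm
  have hfalse : ∀ᵐ x ∂m, False := hm.mono fun x hx => fwdFlow_univ_ne_zero κF c hW x hx
  rwa [eventually_false_iff_eq_bot, ae_eq_bot] at hfalse

/-- A measure under which the reverse acceptance mass integrates to zero is the zero measure. -/
theorem measure_eq_zero_of_lintegral_revFlow_univ [IsMarkovKernel κR] (hW : Measurable W)
    (hs : Measurable s) {m : Measure Ω} (hm : ∫⁻ y, revFlow κR c W s y univ ∂m = 0) : m = 0 := by
  rw [lintegral_eq_zero_iff (measurable_revFlow κR c hW hs MeasurableSet.univ)] at hm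
  have hfalse : ∀ᵐ y ∂m, False := hm.mono fun y hy => revFlow_univ_ne_zero κR c hW y hy
  rwa [eventually_false_iff_eq_bot, ae_eq_bot] at hfalse

/-- The accepted forward flow into `A` is at most the probability that the record ends in `A`. -/
theorem fwdFlow_le_kernel (he : Measurable e) (x : Ω) {A : Set Ω} (hA : MeasurableSet A) :
    fwdFlow κF c W e x A ≤ κF x (e ⁻¹' A) := by
  unfold fwdFlow
  rw [← lintegral_indicator_one (he hA)]
  refine lintegral_mono fun ε => ?_
  calc accF c W ε * A.indicator 1 (e ε) ≤ A.indicator 1 (e ε) :=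
        mul_le_of_le_one_left' (accF_le_one c W ε)
    _ = (e ⁻¹' A).indicator 1 ε := rfl

/-- The accepted reverse flow into `A` is at most the probability that the record starts in `A`. -/
theorem revFlow_le_kernel (hs : Measurable s) (y : Ω) {A : Set Ω} (hA : MeasurableSet A) :
    revFlow κR c W s y A ≤ κR y (s ⁻¹' A) := by
  unfold revFlow
  rw [← lintegral_indicator_one (hs hA)]
  refine lintegral_mono fun ε => ?_
  calc accR c W ε * A.indicator 1 (s ε) ≤ A.indicator 1 (s ε) :=
        mul_le_of_le_one_left' (accR_le_one c W ε)
    _ = (s ⁻¹' A).indicator 1 ε := rfl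

/-- **A minorising measure of an invariant kernel is absolutely continuous with respect to the
invariant weight**: `m ≤ T(z, ·)` for all `z`, `ν ∘ T = ν`, `ν ≠ 0` ⇒ `m ≪ ν`
(`m(A) ν(Ω) = ∫ m(A) dν ≤ ∫ T(z, A) dν = ν(A)`). -/
theorem absolutelyContinuous_of_le_invariant {T : Kernel Ω Ω} {m ν : Measure Ω}
    (hmin : ∀ z, m ≤ T z) (hT : Kernel.Invariant T ν) (hν : ν univ ≠ 0) : m ≪ ν := by
  refine Measure.AbsolutelyContinuous.mk fun A hA hA0 => ?_
  have hle : m A * ν univ ≤ ν A := by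
    calc m A * ν univ = ∫⁻ _, m A ∂ν := (lintegral_const _).symm
      _ ≤ ∫⁻ z, T z A ∂ν := lintegral_mono fun z => (Measure.le_iff'.1 (hmin z)) A
      _ = ν A := by rw [← Measure.bind_apply hA (Kernel.aemeasurable _), hT.def]
  rw [hA0, le_zero_iff, mul_eq_zero] at hle
  exact hle.resolve_right hν

end Flows

/-! ## §3 What Crooks' identity says about where records start and end -/

namespace CrooksPair

variable {ν₀ ν₁ : Measure Ω} {κF κR : Kernel Ω E} {s e : E → Ω} {W : E → ℝ}

/-- Reverse records from `y` end at `y`: `κR(y, e⁻¹ A) = 1_A(y)`. -/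
theorem kernel_end_preimage [IsMarkovKernel κR] (h : CrooksPair ν₀ ν₁ κF κR s e W) {A : Set Ω}
    (hA : MeasurableSet A) (y : Ω) : κR y (e ⁻¹' A) = A.indicator 1 y := by
  rw [← lintegral_indicator_one (h.measurable_e hA)]
  calc ∫⁻ ε, (e ⁻¹' A).indicator 1 ε ∂(κR y) = ∫⁻ _, A.indicator 1 y ∂(κR y) :=
        lintegral_congr_ae ((h.end_ae y).mono fun ε hε => by
          change A.indicator 1 (e ε) = A.indicator 1 y
          rw [hε])
    _ = A.indicator 1 y := by rw [lintegral_const, measure_univ, mul_one]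

/-- Forward records from `x` start at `x`: `κF(x, s⁻¹ A) = 1_A(x)`. -/
theorem kernel_start_preimage [IsMarkovKernel κF] (h : CrooksPair ν₀ ν₁ κF κR s e W) {A : Set Ω}
    (hA : MeasurableSet A) (x : Ω) : κF x (s ⁻¹' A) = A.indicator 1 x := by
  rw [← lintegral_indicator_one (h.measurable_s hA)]
  calc ∫⁻ ε, (s ⁻¹' A).indicator 1 ε ∂(κF x) = ∫⁻ _, A.indicator 1 x ∂(κF x) :=
        lintegral_congr_ae ((h.start_ae x).mono fun ε hε => by
          change A.indicator 1 (s ε) = A.indicator 1 x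
          rw [hε])
    _ = A.indicator 1 x := by rw [lintegral_const, measure_univ, mul_one]

/-- **Forward records end `ν₁`-almost surely where they should**: if `ν₁(A) = 0` then for
`ν₀`-a.e. start `x`, `κF(x, e⁻¹ A) = 0` (Crooks' identity with `e^{−W} > 0`: the tilted forward
record law IS the reverse record law, whose end points are `ν₁`-distributed). -/
theorem ae_kernel_end_null [IsMarkovKernel κR] (h : CrooksPair ν₀ ν₁ κF κR s e W) {A : Set Ω}
    (hA : MeasurableSet A) (hA0 : ν₁ A = 0) : ∀ᵐ x ∂ν₀, κF x (e ⁻¹' A) = 0 := by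
  have hρ : Measurable fun ε => ENNReal.ofReal (Real.exp (-W ε)) :=
    (Real.measurable_exp.comp h.measurable_W.neg).ennreal_ofReal
  have h1 : (ν₁.bind κR) (e ⁻¹' A) = 0 := by
    rw [Measure.bind_apply (h.measurable_e hA) (Kernel.aemeasurable _)]
    simp_rw [h.kernel_end_preimage hA]
    rw [lintegral_indicator_one hA, hA0]
  have h2 : ((ν₀.bind κF).withDensity fun ε => ENNReal.ofReal (Real.exp (-W ε))) (e ⁻¹' A) = 0 := by
    rw [h.crooks]; exact h1
  rw [withDensity_apply_eq_zero hρ] at h2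
  have hsupp : {ε : E | ENNReal.ofReal (Real.exp (-W ε)) ≠ 0} = univ := by
    ext ε
    simp only [mem_setOf_eq, mem_univ, iff_true, Ne, ENNReal.ofReal_eq_zero, not_le]
    exact Real.exp_pos _
  rw [hsupp, univ_inter, Measure.bind_apply (h.measurable_e hA) (Kernel.aemeasurable _),
    lintegral_eq_zero_iff (Kernel.measurable_coe _ (h.measurable_e hA))] at h2
  exact h2

/-- **Reverse records start `ν₀`-almost surely where they should**: if `ν₀(A) = 0` then for
`ν₁`-a.e. end `y`, `κR(y, s⁻¹ A) = 0`. -/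
theorem ae_kernel_start_null [IsMarkovKernel κF] (h : CrooksPair ν₀ ν₁ κF κR s e W) {A : Set Ω}
    (hA : MeasurableSet A) (hA0 : ν₀ A = 0) : ∀ᵐ y ∂ν₁, κR y (s ⁻¹' A) = 0 := by
  have h1 : (ν₀.bind κF) (s ⁻¹' A) = 0 := by
    rw [Measure.bind_apply (h.measurable_s hA) (Kernel.aemeasurable _)]
    simp_rw [h.kernel_start_preimage hA]
    rw [lintegral_indicator_one hA, hA0]
  have h2 : (ν₁.bind κR) (s ⁻¹' A) = 0 := by
    rw [← h.crooks]
    exact withDensity_absolutelyContinuous _ _ h1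
  rw [Measure.bind_apply (h.measurable_s hA) (Kernel.aemeasurable _),
    lintegral_eq_zero_iff (Kernel.measurable_coe _ (h.measurable_s hA))] at h2
  exact h2

/-- Hence: if `ν₁(Aᶜ) = 0`, the accepted forward flow into `A` is the whole forward acceptance mass,
for `ν₀`-a.e. start. -/
theorem ae_fwdFlow_eq_univ [IsMarkovKernel κR] (h : CrooksPair ν₀ ν₁ κF κR s e W) (c : ℝ)
    {A : Set Ω} (hA : MeasurableSet A) (hA0 : ν₁ Aᶜ = 0) :
    ∀ᵐ x ∂ν₀, fwdFlow κF c W e x A = fwdFlow κF c W e x univ := by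
  filter_upwards [h.ae_kernel_end_null hA.compl hA0] with x hx
  have hz : fwdFlow κF c W e x Aᶜ = 0 :=
    le_antisymm ((fwdFlow_le_kernel κF c h.measurable_e x hA.compl).trans hx.le) bot_le
  rw [← fwdFlow_add_compl κF c h.measurable_W h.measurable_e x hA, hz, add_zero]

/-- And: if `ν₀(Aᶜ) = 0`, the accepted reverse flow into `A` is the whole reverse acceptance mass,
for `ν₁`-a.e. end. -/
theorem ae_revFlow_eq_univ [IsMarkovKernel κF] (h : CrooksPair ν₀ ν₁ κF κR s e W) (c : ℝ)
    {A : Set Ω} (hA : MeasurableSet A) (hA0 : ν₀ Aᶜ = 0) :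
    ∀ᵐ y ∂ν₁, revFlow κR c W s y A = revFlow κR c W s y univ := by
  filter_upwards [h.ae_kernel_start_null hA.compl hA0] with y hy
  have hz : revFlow κR c W s y Aᶜ = 0 :=
    le_antisymm ((revFlow_le_kernel κR c h.measurable_s y hA.compl).trans hy.le) bot_le
  rw [← revFlow_add_compl κR c h.measurable_W h.measurable_s y hA, hz, add_zero]

end CrooksPair

end Summit.Ventures.LatticeQCDFlow.Exactness.GeneralNCMC
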